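import Summits.AtomisticToContinuum.Crystallization.Theorems.OverbindingBudgetEnergySiteAffineBound
import Summits.AtomisticToContinuum.Crystallization.Theorems.OverbindingBudgetEnergyLayerProfile

/-!
# OverbindingBudget · decomp-a2c lens-4 g34 — part XXII-R: STR-A from thin layer profiles (global half of STR-A, PROVED)

Helper file under `--supports stmt-AtomisticToContinuum-31280` (RDEF = `Theses.OverbindingBudget.RobustDefectLimitWindows`); closes nothing.

★ `affineStraightenedFloor_of_thin : Λ₁ ≤ 17/16 → LayerProfileThin Λ₁ → AffineStraightenedFloor Λ₁` — the analytic leaf STR-A of the affine cut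
(part O, cone XXXIV) REDUCED to the purely geometric counting statement THIN `LayerProfileThin Λ₁` (part Q: the layer profile of a large cube has
total variation `o(#F)`).  Proof = the local half (part P: every site's half energy is at least `φ₀/2 + Σ_k (α_k + β_k·X_k) − 22/(21 s₀³ η₁⁴)`,
`X_k` the mean of its up/down span heights over `k+1` gaps) summed over the sites `F` of the cube, regrouped layer by layer (part Q), the weighted
mean adjacent height `h̄ = Σ_m N_m X_0(m)/#F ∈ [η₁, η₂]` fed to the affine certificate `AffineBound … h̄ (e + κ″)`, and the Abel drift bound (part Q)
`|Σ_m N_m (X_k(m) − (k+1) X_0(m))| ≤ ((η₂−η₁)/2)·k(k+1)·TV`: the slope-weighted drift is `≤ B(η₂−η₁)s₀³·TV/2 ≤ κ″·#F` once `TV ≤ ε·#F`.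

Cone XXXV `rdef_thirtyfifth_of_recordK_thin_ref`: cone XXXIV with STR-A replaced by THIN — beneath ★ `StackedCellPinningU` the open leaves are now
THIN [ANALYTIC·S: packing + covering counts], GEO-OSC(ω) [CERT·S], FIN-A-T / FIN-A-S [finite CERT·M].
-/

noncomputable section

namespace Summit.AtomisticToContinuum.Crystallization.Theorems.OverbindingBudgetEnergyAffineFloor

open Real Finset
open scoped RealInnerProductSpace
open Literature.MathematicalPhysics.StatisticalMechanics (lennardJones groundStateEnergy)
open Summit.AtomisticToContinuum.Crystallization.Theses.OverbindingBudget (RobustDefectLimitWindows)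
open Summit.AtomisticToContinuum.Crystallization.Theses.PricedLinkCensus (ChargedEnergyGap)
open Summit.AtomisticToContinuum.Crystallization.Theorems.ChargedEnergyGapNegative (eStar)
open Summit.AtomisticToContinuum.Crystallization.Theorems.OverbindingBudgetGradedBareness (CleanlessExcessT)
open Summit.AtomisticToContinuum.Crystallization.Theorems.OverbindingBudgetCoherentCut (CoherentResidual)
open Summit.AtomisticToContinuum.Crystallization.Theorems.OverbindingBudgetUniformCutStatements (GrossCleanBallsU)
open Summit.AtomisticToContinuum.Crystallization.Theorems.OverbindingBudgetElasticSplitScale (CompressedVirialLaw)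
open Summit.AtomisticToContinuum.Crystallization.Theorems.ChartedPlanarOrderChunkFloor (E3)
open Summit.AtomisticToContinuum.Crystallization.Theorems.ChartedPlanarOrderDensityDichotomy (IsSep)
open Summit.AtomisticToContinuum.Crystallization.Theorems.ChartedPlanarOrderDoorLayered (Layered)
open Summit.AtomisticToContinuum.Crystallization.Theorems.ChartedPlanarOrderProfileSlavingLJ (incr)
open Summit.AtomisticToContinuum.Crystallization.Theorems.OverbindingBudgetScaleWidening (DoorPeriodicW)
open Summit.AtomisticToContinuum.Crystallization.Theorems.OverbindingBudgetTwoShellShape (TwoShellShape BarlowGluingW)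
open Summit.AtomisticToContinuum.Crystallization.Theorems.OverbindingBudgetStackedRigidityW (StackedReductionW GapStressVanishesW)
open Summit.AtomisticToContinuum.Crystallization.Theorems.OverbindingBudgetRegistryCut (IsUnitNormal RegistryResidual RegistryTube)
open Summit.AtomisticToContinuum.Crystallization.Theorems.OverbindingBudgetRegistryDichotomy (RegistryGeometryW BalancedLocus)
open Summit.AtomisticToContinuum.Crystallization.Theorems.OverbindingBudgetRegistryDichotomyCW (RegistryMetricCW)
open Summit.AtomisticToContinuum.Crystallization.Theorems.OverbindingBudgetEnergyPinningCut (siteEnergy MeanSiteEnergyFloor)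
open Summit.AtomisticToContinuum.Crystallization.Theorems.OverbindingBudgetEnergyStraightening (layerField)
open Summit.AtomisticToContinuum.Crystallization.Theorems.OverbindingBudgetEnergyTubeBox (RegistryPinningP TubeConvexRefP)
open Summit.AtomisticToContinuum.Crystallization.Theorems.OverbindingBudgetEnergyAffineStraightening (AffineBound AffineStraightenedFloor
  StackedHeightsOsc AffineCellEnergyT AffineSquareExtinct rdef_thirtyfourth_of_recordK_affine_ref)
open Summit.AtomisticToContinuum.Crystallization.Theorems.OverbindingBudgetEnergySiteAffineBound (span_height_bounds_up span_height_bounds_down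
  inner_sub_up inner_sub_down siteEnergy_half_affine_lower)
open Summit.AtomisticToContinuum.Crystallization.Theorems.OverbindingBudgetEnergyLayerProfile (tv tv_nonneg drift_up_le drift_down_le
  tv_le_of_sum_le layerOf layerCount layerOf_spec layerCount_nonneg layerCount_vanish sum_eq_sum_layerCount sum_layerCount LayerProfileThin)

/-! ## §1 Span means of a layer and their drift against the adjacent mean -/

/-- the mean of the up- and down-span heights over `k+1` gaps seen from layer `m`. -/
def spanMean (w : ℤ → E3) (n : E3) (k : ℕ) (m : ℤ) : ℝ :=
  (⟪w (m + ((k : ℤ) + 1)) - w m, n⟫ + ⟪w m - w (m - ((k : ℤ) + 1)), n⟫) / 2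

/-- the adjacent span mean lies in the band. [this file] -/
theorem spanMean_zero_mem {w : ℤ → E3} {n : E3} {η₁ η₂ : ℝ} (hband : ∀ m : ℤ, η₁ ≤ ⟪incr w m, n⟫ ∧ ⟪incr w m, n⟫ ≤ η₂) (m : ℤ) :
    η₁ ≤ spanMean w n 0 m ∧ spanMean w n 0 m ≤ η₂ := by
  obtain ⟨u1, u2⟩ := span_height_bounds_up hband m 0
  obtain ⟨d1, d2⟩ := span_height_bounds_down hband m 0
  simp only [Nat.cast_zero, zero_add, one_mul] at u1 u2 d1 d2
  simp only [spanMean, Nat.cast_zero]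
  constructor <;> linarith

/-- the drift of the `k`-span mean against `(k+1)` adjacent means, as a sum of gap-height differences. [this file] -/
theorem spanMean_sub (w : ℤ → E3) (n : E3) (k : ℕ) (m : ℤ) :
    spanMean w n k m - ((k : ℝ) + 1) * spanMean w n 0 m =
      ∑ i ∈ range (k + 1), ((⟪incr w (m + 1 + i), n⟫ - ⟪incr w (m + 1), n⟫) / 2 + (⟪incr w (m - i), n⟫ - ⟪incr w m, n⟫) / 2) := by
  have hup : ⟪w (m + ((k : ℤ) + 1)) - w m, n⟫ = ∑ i ∈ range (k + 1), ⟪incr w (m + 1 + i), n⟫ := by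
    rw [inner_sub_up]
    exact sum_congr rfl fun i _ => by rw [show m + ((i : ℤ) + 1) = m + 1 + i by ring]
  have hdown : ⟪w m - w (m - ((k : ℤ) + 1)), n⟫ = ∑ i ∈ range (k + 1), ⟪incr w (m - i), n⟫ := inner_sub_down w n m k
  have h0up : ⟪w (m + (((0 : ℕ) : ℤ) + 1)) - w m, n⟫ = ⟪incr w (m + 1), n⟫ := by
    rw [inner_sub_up, sum_range_one, show m + (((0 : ℕ) : ℤ) + 1) = m + 1 by push_cast; ring]
  have h0down : ⟪w m - w (m - (((0 : ℕ) : ℤ) + 1)), n⟫ = ⟪incr w m, n⟫ := by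
    rw [inner_sub_down, sum_range_one, show m - ((0 : ℕ) : ℤ) = m by push_cast; ring]
  simp only [spanMean]
  rw [hup, hdown, h0up, h0down, sum_add_distrib, ← sum_div, ← sum_div, sum_sub_distrib, sum_sub_distrib]
  simp only [sum_const, card_range, nsmul_eq_mul]
  push_cast
  ring

/-- **the slope-free drift of one span length**: `|Σ_m N_m (X_k(m) − (k+1) X_0(m))| ≤ ((η₂−η₁)/2)·k·(k+1)·TV`. [this file] -/
theorem abs_sum_spanMean_drift_le {N : ℤ → ℝ} {M : Finset ℤ} {w : ℤ → E3} {n : E3} {η₁ η₂ : ℝ} (hN : ∀ m ∉ M, N m = 0)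
    (hband : ∀ m : ℤ, η₁ ≤ ⟪incr w m, n⟫ ∧ ⟪incr w m, n⟫ ≤ η₂) (k : ℕ) :
    |∑ m ∈ M, N m * (spanMean w n k m - ((k : ℝ) + 1) * spanMean w n 0 m)| ≤ (η₂ - η₁) / 2 * k * (k + 1) * tv N := by
  set hgt : ℤ → ℝ := fun q => ⟪incr w q, n⟫ with hh
  have hω : 0 ≤ (η₂ - η₁) / 2 := by linarith [(hband 0).1, (hband 0).2]
  have htv := tv_nonneg N
  have e1 : ∑ m ∈ M, N m * (spanMean w n k m - ((k : ℝ) + 1) * spanMean w n 0 m) =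
      ∑ i ∈ range (k + 1), ((∑ m ∈ M, N m * (hgt (m + 1 + i) - hgt (m + 1))) / 2 + (∑ m ∈ M, N m * (hgt (m - i) - hgt m)) / 2) := by
    simp_rw [spanMean_sub, mul_sum]
    rw [sum_comm]
    refine sum_congr rfl fun i _ => ?_
    rw [sum_div, sum_div, ← sum_add_distrib]
    exact sum_congr rfl fun m _ => by simp only [hh]; ring
  rw [e1]
  have hterm : ∀ i ∈ range (k + 1), |(∑ m ∈ M, N m * (hgt (m + 1 + i) - hgt (m + 1))) / 2 + (∑ m ∈ M, N m * (hgt (m - i) - hgt m)) / 2|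
      ≤ (η₂ - η₁) / 2 * k * tv N := by
    intro i hi
    have hik : (i : ℝ) ≤ k := by exact_mod_cast Nat.lt_succ_iff.1 (mem_range.1 hi)
    have hu := drift_up_le (h := hgt) hN (fun m => hband m) i
    have hd := drift_down_le (h := hgt) hN (fun m => hband m) i
    have hmono : (η₂ - η₁) / 2 * i * tv N ≤ (η₂ - η₁) / 2 * k * tv N :=
      mul_le_mul_of_nonneg_right (mul_le_mul_of_nonneg_left hik hω) htv
    calc _ ≤ |(∑ m ∈ M, N m * (hgt (m + 1 + i) - hgt (m + 1))) / 2| + |(∑ m ∈ M, N m * (hgt (m - i) - hgt m)) / 2| := abs_add_le _ _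
      _ ≤ (η₂ - η₁) / 2 * k * tv N := by rw [abs_div, abs_div, abs_two]; linarith
  calc _ ≤ ∑ i ∈ range (k + 1), |(∑ m ∈ M, N m * (hgt (m + 1 + i) - hgt (m + 1))) / 2 + (∑ m ∈ M, N m * (hgt (m - i) - hgt m)) / 2| :=
        abs_sum_le_sum_abs _ _
    _ ≤ ∑ i ∈ range (k + 1), (η₂ - η₁) / 2 * k * tv N := sum_le_sum hterm
    _ = (η₂ - η₁) / 2 * k * (k + 1) * tv N := by rw [sum_const, card_range, nsmul_eq_mul]; push_cast; ring

/-! ## §2 ★ STR-A from THIN -/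
set_option maxHeartbeats 400000 in
/-- ★ **STR-A from thin layer profiles.** `Λ₁ ≤ 17/16 → LayerProfileThin Λ₁ → AffineStraightenedFloor Λ₁`. [this file] -/
theorem affineStraightenedFloor_of_thin {Λ₁ : ℝ} (hΛ₁ : Λ₁ ≤ 17 / 16) (hThin : LayerProfileThin Λ₁) : AffineStraightenedFloor Λ₁ := by
  intro δ hδ a b w hab ha hb hs n hn η₁ η₂ h38 h2320 hband e κ'' hκ s₀ hs₀ B hAff
  classical
  have ha' : ‖a‖ ≤ 17 / 16 := ha.trans hΛ₁
  have hb' : ‖b‖ ≤ 17 / 16 := hb.trans hΛ₁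
  have hη12 : η₁ ≤ η₂ := (hband 0).1.trans (hband 0).2
  have hω : 0 ≤ η₂ - η₁ := sub_nonneg.2 hη12
  have hs₀1 : 1 ≤ s₀ := le_trans (by norm_num) hs₀
  have hB : 0 ≤ B := by
    obtain ⟨α, β, hβ, -, -⟩ := hAff η₁ ⟨le_rfl, hη12⟩
    exact (abs_nonneg _).trans (hβ 0 (by omega))
  set D : ℝ := B * (η₂ - η₁) / 2 * (s₀ : ℝ) ^ 3 with hDdef
  have hD : 0 ≤ D := by positivity
  set ε : ℝ := κ'' / (D + 1) with hεdef
  have hε : 0 < ε := by positivity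
  have hDε : D * ε ≤ κ'' := by
    rw [hεdef, mul_div_assoc', div_le_iff₀ (by positivity)]
    nlinarith
  have hband' : ∀ m : ℤ, 3 / 8 ≤ ⟪incr w m, n⟫ ∧ ⟪incr w m, n⟫ ≤ 23 / 20 :=
    fun m => ⟨h38.trans (hband m).1, (hband m).2.trans h2320⟩
  obtain ⟨ℓ₁, hℓ₁⟩ := hThin δ hδ a b w hab ha hb hs n hn hband' ε hε
  refine ⟨ℓ₁, fun ℓ hℓ c F hF => ?_⟩
  have hTV : tv (layerCount a b w F) ≤ ε * F.card := tv_le_of_sum_le (hℓ₁ ℓ hℓ c F hF)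
  rcases F.eq_empty_or_nonempty with hF0 | hFne
  · subst hF0; simp
  have hcard : (0 : ℝ) < F.card := by exact_mod_cast hFne.card_pos
  set N : ℤ → ℝ := layerCount a b w F with hNdef
  set M : Finset ℤ := F.image (layerOf a b w) with hMdef
  have hN : ∀ m ∉ M, N m = 0 := layerCount_vanish a b w F
  have hN0 : ∀ m, 0 ≤ N m := layerCount_nonneg a b w F
  have hsumN : ∑ m ∈ M, N m = F.card := sum_layerCount a b w F
  -- the weighted mean adjacent height
  set hbar : ℝ := (∑ m ∈ M, N m * spanMean w n 0 m) / F.card with hbardef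
  have hbarF : hbar * F.card = ∑ m ∈ M, N m * spanMean w n 0 m := div_mul_cancel₀ _ hcard.ne'
  have hbar_mem : hbar ∈ Set.Icc η₁ η₂ := by
    have lo : η₁ * F.card ≤ ∑ m ∈ M, N m * spanMean w n 0 m := by
      rw [← hsumN, mul_sum]
      exact sum_le_sum fun m _ => by nlinarith [hN0 m, (spanMean_zero_mem hband m).1]
    have hi : ∑ m ∈ M, N m * spanMean w n 0 m ≤ η₂ * F.card := by
      rw [← hsumN, mul_sum]
      exact sum_le_sum fun m _ => by nlinarith [hN0 m, (spanMean_zero_mem hband m).2]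
    exact ⟨(le_div_iff₀ hcard).2 lo, (div_le_iff₀ hcard).2 hi⟩
  obtain ⟨α, β, hβB, hmin, hiii⟩ := hAff hbar hbar_mem
  -- the local half at every site of the cube
  set T : ℝ := 22 / (21 * (s₀ : ℝ) ^ 3 * η₁ ^ 4) with hTdef
  have hY : ∀ y ∈ F, y ∈ Layered a b w := fun y hy => by
    have : (y : E3) ∈ (↑F : Set E3) := hy
    rw [hF] at this
    exact this.1
  have hsite : ∀ y ∈ F, layerField a b 0 / 2 + ∑ k ∈ range s₀, (α k + β k * spanMean w n k (layerOf a b w y)) - T ≤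
      siteEnergy (Layered a b w) y / 2 := by
    intro y hy
    obtain ⟨i, j, hyw⟩ := layerOf_spec (hY y hy)
    have h := siteEnergy_half_affine_lower hδ hab ha' hb' hs hn h38 hband hs₀ hmin (layerOf a b w y) i j
    rw [← hyw] at h
    simpa only [spanMean] using h
  -- sum over the cube and regroup layer by layer
  have hsum : (F.card : ℝ) * (layerField a b 0 / 2 - T) +
      ∑ k ∈ range s₀, (α k * F.card + β k * ∑ m ∈ M, N m * spanMean w n k m) ≤ ∑ y ∈ F, siteEnergy (Layered a b w) y / 2 := by
    have e : ∑ y ∈ F, (layerField a b 0 / 2 + ∑ k ∈ range s₀, (α k + β k * spanMean w n k (layerOf a b w y)) - T) =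
        (F.card : ℝ) * (layerField a b 0 / 2 - T) + ∑ k ∈ range s₀, (α k * F.card + β k * ∑ m ∈ M, N m * spanMean w n k m) := by
      have e2 : ∑ y ∈ F, ∑ k ∈ range s₀, (α k + β k * spanMean w n k (layerOf a b w y)) =
          ∑ k ∈ range s₀, (α k * F.card + β k * ∑ m ∈ M, N m * spanMean w n k m) := by
        rw [sum_comm]
        refine sum_congr rfl fun k _ => ?_
        rw [sum_add_distrib, sum_const, nsmul_eq_mul, ← mul_sum, ← sum_eq_sum_layerCount a b w F (spanMean w n k)]
        ring
      rw [sum_sub_distrib, sum_add_distrib, e2, sum_const, sum_const, nsmul_eq_mul, nsmul_eq_mul]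
      ring
    rw [← e]
    exact sum_le_sum hsite
  -- the drift, slope-weighted
  have hdrift : ∀ k ∈ range s₀, |β k * (∑ m ∈ M, N m * spanMean w n k m - ((k : ℝ) + 1) * hbar * F.card)| ≤
      B * ((η₂ - η₁) / 2 * (s₀ : ℝ) * s₀ * tv N) := by
    intro k hk
    have hks : k < s₀ := mem_range.1 hk
    have hk1 : (k : ℝ) + 1 ≤ s₀ := by exact_mod_cast hks
    have hk0 : (k : ℝ) ≤ s₀ := by linarith
    have e : ∑ m ∈ M, N m * spanMean w n k m - ((k : ℝ) + 1) * hbar * F.card =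
        ∑ m ∈ M, N m * (spanMean w n k m - ((k : ℝ) + 1) * spanMean w n 0 m) := by
      rw [mul_assoc, hbarF, mul_sum, ← sum_sub_distrib]
      exact sum_congr rfl fun m _ => by ring
    rw [abs_mul, e]
    have hd := abs_sum_spanMean_drift_le hN hband k
    have htv := tv_nonneg N
    have hkk : (η₂ - η₁) / 2 * k * (k + 1) * tv N ≤ (η₂ - η₁) / 2 * (s₀ : ℝ) * s₀ * tv N := by
      have : (k : ℝ) * (k + 1) ≤ (s₀ : ℝ) * s₀ := by nlinarith
      have hω2 : 0 ≤ (η₂ - η₁) / 2 := by linarith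
      nlinarith [mul_nonneg hω2 htv]
    exact mul_le_mul (hβB k hks) (hd.trans hkk) (abs_nonneg _) hB
  have hdriftSum : |∑ k ∈ range s₀, β k * (∑ m ∈ M, N m * spanMean w n k m - ((k : ℝ) + 1) * hbar * F.card)| ≤ D * tv N := by
    refine (abs_sum_le_sum_abs _ _).trans ((sum_le_sum hdrift).trans ?_)
    rw [sum_const, card_range, nsmul_eq_mul, hDdef]
    ring_nf
    rfl
  -- assemble
  have e3 : ∑ k ∈ range s₀, (α k * F.card + β k * ∑ m ∈ M, N m * spanMean w n k m) =
      (F.card : ℝ) * ∑ k ∈ range s₀, (α k + β k * (((k : ℝ) + 1) * hbar)) +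
        ∑ k ∈ range s₀, β k * (∑ m ∈ M, N m * spanMean w n k m - ((k : ℝ) + 1) * hbar * F.card) := by
    rw [mul_sum, ← sum_add_distrib]
    exact sum_congr rfl fun k _ => by ring
  have hlow := neg_abs_le (∑ k ∈ range s₀, β k * (∑ m ∈ M, N m * spanMean w n k m - ((k : ℝ) + 1) * hbar * F.card))
  have hDtv : D * tv N ≤ κ'' * F.card := by
    calc D * tv N ≤ D * (ε * F.card) := mul_le_mul_of_nonneg_left hTV hD
      _ = D * ε * F.card := by ring
      _ ≤ κ'' * F.card := mul_le_mul_of_nonneg_right hDε hcard.le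
  rw [e3] at hsum
  have hmain : (F.card : ℝ) * (e + κ'') ≤ (F.card : ℝ) * (layerField a b 0 / 2 - T + ∑ k ∈ range s₀, (α k + β k * (((k : ℝ) + 1) * hbar))) :=
    mul_le_mul_of_nonneg_left (by rw [hTdef]; linarith) hcard.le
  linarith

/-! ## §3 Cone XXXV: THIN in place of STR-A -/

/-- **Cone XXXV · `rdef_thirtyfifth_of_recordK_thin_ref`** — cone XXXIV with the analytic leaf STR-A discharged down to the geometric counting
statement THIN `LayerProfileThin (17/16)`.  Open leaves beneath ★: THIN [ANALYTIC·S], GEO-OSC(ω) [CERT·S], FIN-A-T / FIN-A-S [finite CERT·M]. [this file] -/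
theorem rdef_thirtyfifth_of_recordK_thin_ref (s₁ s₂ h₀ κ' ω B : ℝ) (s₀ : ℕ) (hκ' : 0 < κ') (hs₀ : 4 ≤ s₀)
    (hG : GrossCleanBallsU (1 / 250) 10)
    (hCEG : ChargedEnergyGap) (hC : CompressedVirialLaw (1 / 250) 10) (hS : TwoShellShape (1 / 100) (3 / 50) (1 / 450)) (hB₂ : BarlowGluingW)
    (hD : DoorPeriodicW 2) (hSR : StackedReductionW 2 (17 / 16)) (hV : GapStressVanishesW (17 / 16))
    (hP : RegistryPinningP (17 / 16) (1 / 40) (3 / 16) s₁ s₂ 1 0) (hT : TubeConvexRefP (17 / 16) (1 / 40) s₁ s₂ 1 0)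
    (hThin : LayerProfileThin (17 / 16)) (hOSC : StackedHeightsOsc (17 / 16) ω)
    (hFT : AffineCellEnergyT (17 / 16) s₁ s₂ ω s₀ B (eStar + 2 * κ')) (hFS : AffineSquareExtinct (17 / 16) ω s₀ B (eStar + 2 * κ'))
    (hGeo : RegistryGeometryW (17 / 16) s₁ s₂ h₀ (3 / 20))
    (hBal : BalancedLocus s₁ s₂ h₀ (1 / 40)) (hR1 : RegistryResidual s₁ s₂ (1 / 250)) (hR2 : RegistryTube s₁ s₂ (1 / 100) 1)
    (hMet : RegistryMetricCW s₁ s₂ (3 / 500)) (hCE : CleanlessExcessT) (hRes : CoherentResidual 10) : RobustDefectLimitWindows :=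
  rdef_thirtyfourth_of_recordK_affine_ref s₁ s₂ h₀ κ' ω B s₀ hκ' hs₀ hG hCEG hC hS hB₂ hD hSR hV hP hT
    (affineStraightenedFloor_of_thin le_rfl hThin) hOSC hFT hFS hGeo hBal hR1 hR2 hMet hCE hRes

end Summit.AtomisticToContinuum.Crystallization.Theorems.OverbindingBudgetEnergyAffineFloor

end
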